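import Literature.AlgebraicGeometry.KTheory.GraysonRelativeKZero
import Literature.AlgebraicGeometry.KTheory.PullbackAcyclicVBComplex
import HarnessLib

/-!
# Functoriality of Grayson's `K₀Ω[f^*]` in the base: restriction along `g : X ⟶ X'`

For morphisms of schemes `f : Y ⟶ X`, `g : X ⟶ X'`, the pull-back `g^* : Vect(X') → Vect(X)` and
the identity of `Vect(Y)` form a map of pairs `[(f ≫ g)^*] → [f^*]` in Grayson's sense
(arXiv:1310.8644, §1 and Theorem 7: the exact sequence is functorial, its maps being "induced by the
maps of pairs"), because `f^* ∘ g^* ≅ (f ≫ g)^*`. On presentations it sends an object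
`(M, N, u)` of `B[(f ≫ g)^*]` to `(g^*M, N, u ∘ (f^*g^*M ≅ (f ≫ g)^*M))` of `B[f^*]`; it preserves the
short exact sequences (`g^*` is exact on vector bundles, `KTheory/PullbackVectorBundle`), the diagonal
objects and the weak equivalences (`g^*` preserves quasi-isomorphisms between bounded complexes of
vector bundles, `KTheory/PullbackAcyclicVBComplex`). This file constructs the induced homomorphism

* `RelKZero.restrict f g : K₀Ω[(f ≫ g)^*] →+ K₀Ω[f^*]`, with `restrict_mk`, and
* `RelKZero.toKZero_restrict : toKZero (restrict f g x) = g^*(toKZero x)` — compatibility with the maps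
  to `K₀` (`K₀(X') → K₀(X)` being `g^*`), i.e. the commutative square of Theorem 7's sequences for the
  map of pairs.

For X. Hu's thickenings (`Y = X_m`, `X = X_n`, `X' = X_{n'}`, `m ≤ n ≤ n'`) this is the restriction
`K₀(X_{n'}, X_m) → K₀(X_n, X_m)` of presented relative groups under which clause (b) of
`HuKZeroKernelPresentation` is a naturality statement. Everything is proved; no named facts.

## References

* D. R. Grayson, *Relative algebraic K-theory by elementary means*, arXiv:1310.8644 (2013), §1,
  Theorem 7. [Grayson2013RelativeKTheory]
-/

universe u

open CategoryTheory CategoryTheory.Limits AlgebraicGeometry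
open Literature.AlgebraicGeometry.Motives

noncomputable section

namespace Literature.AlgebraicGeometry.KTheory

variable {Y X X' : Scheme.{u}} (f : Y ⟶ X) (g : X ⟶ X')

/-- `f^*(g^*M) ≅ (f ≫ g)^*M` on cochain complexes of `𝒪`-modules (Mathlib's `Scheme.Modules.pullbackComp`
term by term). [folklore] -/
def pullbackComplexCompIso (M : CochainComplex X'.Modules ℤ) :
    (pullbackComplex f).obj ((pullbackComplex g).obj M) ≅ (pullbackComplex (f ≫ g)).obj M :=
  (NatIso.mapHomologicalComplex (Scheme.Modules.pullbackComp f g) (ComplexShape.up ℤ)).app M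

/-- Naturality of `f^*(g^*M) ≅ (f ≫ g)^*M`. [folklore] -/
@[reassoc]
theorem pullbackComplexCompIso_hom_naturality {M M' : CochainComplex X'.Modules ℤ} (φ : M ⟶ M') :
    (pullbackComplex f).map ((pullbackComplex g).map φ) ≫ (pullbackComplexCompIso f g M').hom =
      (pullbackComplexCompIso f g M).hom ≫ (pullbackComplex (f ≫ g)).map φ :=
  (NatIso.mapHomologicalComplex (Scheme.Modules.pullbackComp f g) (ComplexShape.up ℤ)).hom.naturality φ

namespace GraysonTriple

variable {f g}

/-- **Restriction of an object of `B[(f ≫ g)^*]` to `B[f^*]`**: `(M, N, u) ↦ (g^*M, N, u ∘ (f^*g^*M ≅ (f ≫ g)^*M))`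
(the map of pairs `(g^*, 1)`). [cite: Grayson2013RelativeKTheory, Theorem 7] -/
def restrict (T : GraysonTriple (f ≫ g)) : GraysonTriple f where
  M₁ := (pullbackComplex g).obj T.M₁
  M₂ := (pullbackComplex g).obj T.M₂
  N := T.N
  u₁ := (pullbackComplexCompIso f g T.M₁).hom ≫ T.u₁
  u₂ := (pullbackComplexCompIso f g T.M₂).hom ≫ T.u₂
  hM₁ := T.hM₁.pullback g
  hM₂ := T.hM₂.pullback g
  hN := T.hN
  quasiIso₁ := by have := T.quasiIso₁; infer_instance
  quasiIso₂ := by have := T.quasiIso₂; infer_instance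

/-- Restriction of morphisms of triples. [cite: Grayson2013RelativeKTheory, Theorem 7] -/
def Hom.restrict {T T' : GraysonTriple (f ≫ g)} (h : Hom T T') : Hom T.restrict T'.restrict where
  φ₁ := (pullbackComplex g).map h.φ₁
  φ₂ := (pullbackComplex g).map h.φ₂
  γ := h.γ
  comm₁ := by
    change (pullbackComplex f).map ((pullbackComplex g).map h.φ₁) ≫
      (pullbackComplexCompIso f g T'.M₁).hom ≫ T'.u₁ =
      ((pullbackComplexCompIso f g T.M₁).hom ≫ T.u₁) ≫ h.γ.top
    rw [pullbackComplexCompIso_hom_naturality_assoc, h.comm₁, Category.assoc]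
  comm₂ := by
    change (pullbackComplex f).map ((pullbackComplex g).map h.φ₂) ≫
      (pullbackComplexCompIso f g T'.M₂).hom ≫ T'.u₂ =
      ((pullbackComplexCompIso f g T.M₂).hom ≫ T.u₂) ≫ h.γ.bot
    rw [pullbackComplexCompIso_hom_naturality_assoc, h.comm₂, Category.assoc]

/-- Restriction preserves short exact sequences of triples (`g^*` is exact on short exact sequences of
vector bundles, degreewise). [cite: Grayson2013RelativeKTheory, Theorem 7] -/
theorem IsShortExact.restrict {T' T T'' : GraysonTriple (f ≫ g)} {a : Hom T' T} {b : Hom T T''}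
    (h : IsShortExact a b) : IsShortExact a.restrict b.restrict := by
  obtain ⟨h₁, h₂, h₃⟩ := h
  refine ⟨fun i ↦ ?_, fun i ↦ ?_, h₃⟩
  · obtain ⟨w, hw⟩ := h₁ i
    exact ⟨_, shortExact_map_pullback g hw (T''.hM₁.isFiniteLocallyFree i)⟩
  · obtain ⟨w, hw⟩ := h₂ i
    exact ⟨_, shortExact_map_pullback g hw (T''.hM₂.isFiniteLocallyFree i)⟩

/-- Restriction preserves the weak equivalences `p` (`g^*` preserves quasi-isomorphisms between bounded
complexes of vector bundles). [cite: Grayson2013RelativeKTheory, Theorem 7] -/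
theorem Hom.IsWeakEquiv.restrict {T T' : GraysonTriple (f ≫ g)} {h : Hom T T'} (hh : h.IsWeakEquiv) :
    h.restrict.IsWeakEquiv := by
  obtain ⟨hq₁, hq₂, hγ⟩ := hh
  exact ⟨T.hM₁.quasiIso_pullback_map g T'.hM₁ h.φ₁, T.hM₂.quasiIso_pullback_map g T'.hM₂ h.φ₂, hγ⟩

/-- Restriction of objects of `C[(f ≫ g)^*]`. [cite: Grayson2013RelativeKTheory, Theorem 7] -/
def CTriple.restrict (c : CTriple (f ≫ g)) : CTriple f where
  M := (pullbackComplex g).obj c.M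
  N := c.N
  u := (pullbackComplexCompIso f g c.M).hom ≫ c.u
  hM := c.hM.pullback g
  hN := c.hN
  quasiIso := by have := c.quasiIso; infer_instance

/-- Restriction commutes with the diagonal: `Δ(c)|_f = Δ(c|_f)`. [cite: Grayson2013RelativeKTheory, Theorem 7] -/
theorem CTriple.restrict_diag (c : CTriple (f ≫ g)) : c.diag.restrict = c.restrict.diag := rfl

/-- `χ` of the restriction is `g^*` of `χ`: `χ(g^*M₁) − χ(g^*M₂) = g^*(χ(M₁) − χ(M₂))`.
[cite: Grayson2013RelativeKTheory, Theorem 7] -/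
theorem chi_restrict (T : GraysonTriple (f ≫ g)) : T.restrict.chi = KZero.map g T.chi := by
  change eulerChar _ _ - eulerChar _ _ = KZero.map g (eulerChar _ _ - eulerChar _ _)
  rw [map_sub, map_eulerChar g T.hM₁, map_eulerChar g T.hM₂]
  rfl

end GraysonTriple

namespace RelKZero

/-- **The restriction homomorphism `K₀Ω[(f ≫ g)^*] → K₀Ω[f^*]`** induced by the map of pairs `(g^*, 1)`
(Grayson: the sequences of Theorem 7 are "induced by the maps of pairs"); well defined on the
presentation since restriction preserves short exact sequences, diagonal objects and weak equivalences.
[cite: Grayson2013RelativeKTheory, Theorem 7] -/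
def restrict : RelKZero (f ≫ g) →+ RelKZero f :=
  QuotientAddGroup.map (relations (f ≫ g)) (relations f)
    (FreeAbelianGroup.map GraysonTriple.restrict) ((AddSubgroup.closure_le _).mpr (by
      rintro x ((⟨T', T, T'', a, b, h, rfl⟩ | ⟨c, rfl⟩) | ⟨T, T', h, hh, rfl⟩)
      · simp only [SetLike.mem_coe, AddSubgroup.mem_comap, map_sub, FreeAbelianGroup.map_of_apply]
        exact AddSubgroup.subset_closure (Or.inl (Or.inl
          ⟨T'.restrict, T.restrict, T''.restrict, a.restrict, b.restrict, h.restrict, rfl⟩))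
      · simp only [SetLike.mem_coe, AddSubgroup.mem_comap, FreeAbelianGroup.map_of_apply]
        exact AddSubgroup.subset_closure (Or.inl (Or.inr ⟨c.restrict, c.restrict_diag ▸ rfl⟩))
      · simp only [SetLike.mem_coe, AddSubgroup.mem_comap, map_sub, FreeAbelianGroup.map_of_apply]
        exact AddSubgroup.subset_closure (Or.inr ⟨T.restrict, T'.restrict, h.restrict, hh.restrict, rfl⟩)))

variable {f g}

/-- Restriction on classes: `[(M, N, u)] ↦ [(g^*M, N, u ∘ ≅)]`. [cite: Grayson2013RelativeKTheory, Theorem 7] -/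
@[simp]
theorem restrict_mk (T : GraysonTriple (f ≫ g)) : restrict f g (mk T) = mk T.restrict :=
  QuotientAddGroup.map_mk' _ _ _ _ _

/-- **Compatibility with the maps to `K₀`**: `toKZero ∘ restrict = g^* ∘ toKZero` — the square of
Theorem 7's sequences `K₀Ω[(f ≫ g)^*] → K₀(X')`, `K₀Ω[f^*] → K₀(X)` under the map of pairs `(g^*, 1)`
commutes. [cite: Grayson2013RelativeKTheory, Theorem 7] -/
theorem toKZero_restrict (x : RelKZero (f ≫ g)) :
    toKZero (restrict f g x) = KZero.map g (toKZero x) := by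
  induction x using RelKZero.induction_on with
  | zero => simp only [map_zero]
  | of T => rw [restrict_mk, toKZero_mk, toKZero_mk, T.chi_restrict]
  | neg x hx => simp only [map_neg, hx]
  | add x y hx hy => simp only [map_add, hx, hy]

end RelKZero

end Literature.AlgebraicGeometry.KTheory

end
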